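import Mathlib
import Summits.CriticalPhenomena.PercolationContinuityZ3.Theorems.PercNearOneGluingNoHeavyLowerTailTNKernels
import Summits.CriticalPhenomena.PercolationContinuityZ3.Theorems.PercNearOneGluingNoHeavyLowerTailDiffHurwitzChain
import Summits.CriticalPhenomena.PercolationContinuityZ3.Theorems.PercNearOneGluingNoHeavyLowerTailHurwitzPairPivots
import HarnessLib

/-!
# The extreme-ray normal form of an operator Hurwitz matrix

Support file for the Sahi / Conjecture-P programme of route `PercNearOneGluingNoHeavy`
(`--supports stmt-CriticalPhenomena-4575`, prover prim-l12-p5 gen 50; proof note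
`prim-l12-p5/PROOF-DRIFTING-HURWITZ-g50.md` §0(i), §1).  No definitions, no named facts, no sorries.

For a lower band matrix `W` (rows `w_n`) the operator Hurwitz matrix is the doubled kernel `t = 2n ↦ w_n`,
`t = 2n+1 ↦ c_n = w_{n+1} - σ w_n` (`σ` = right shift).  The two rows `σw_{n-1}, w_n` have the same support
and span a plane whose EXTREME RAYS are `A_n = π_{n-1}w_n - π_nσw_{n-1}` (top entry killed) and
`B_n = b_nσw_{n-1} - b_{n-1}w_n` (bottom entry killed), `π_n = W(n,n)`, `b_n` = the lowest band; with
`Δ_n = π_{n-1}b_n - π_n b_{n-1}` one has `c_{n-1} = ((b_n-b_{n-1})A_n + (π_n-π_{n-1})B_n)/Δ_n` and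
`w_n = (b_nA_n + π_nB_n)/Δ_n`: every block (rows `2n-1, 2n`) of the Hurwitz kernel is a nonnegative `2×2`
combination, with positive determinant, of the two rays.  Hence (this file, stated abstractly):

**THEOREM (`hurwitz_tn_of_rays`).**  Let `X, Y, A, B` be kernels and `p₁₁, p₁₂, p₂₁, p₂₂ : ℕ → ℝ` with
`p₁₁ > 0`, `p₁₂, p₂₁ ≥ 0`, `p₁₁p₂₂ - p₁₂p₂₁ > 0`, `Y (n-1) = p₁₁ n·A n + p₁₂ n·B n` and
`X n = p₂₁ n·A n + p₂₂ n·B n` for `n ≥ 1`.  If the RAY KERNEL `t = 0 ↦ X 0`, `t = 2n-1 ↦ A n`, `t = 2n ↦ B n`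
(`n ≥ 1`) is totally nonnegative, so is the Hurwitz kernel `t = 2n ↦ X n`, `t = 2n+1 ↦ Y n`.
(Two adjacent-row steps `DiffHurwitz.stepUp_tn`, `HurwitzPair.step_tn` and a positive row scaling.)  For the
ordered products of CONJECTURE R^prod the ray kernel is the DRIFTING HURWITZ MATRIX of the memo; this lemma is
the formal half of "drifting-Hurwitz TN ⟹ R(W) TN".
-/

namespace Summit.CriticalPhenomena.PercolationContinuityZ3.Theorems

namespace ExtremeRay

open Finset Matrix

/-- The scalar identity behind the block factorisation `[[p₁₁,p₁₂],[p₂₁,p₂₂]] = D·L·U`. -/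
theorem ray_identity (A B p11 p12 p21 p22 : ℝ) (hp : 0 < p11) (hD : 0 < p11 * p22 - p12 * p21) :
    p21 * A + p22 * B =
      (p11 * p22 - p12 * p21) / p11 * (B + p11 * p21 / (p11 * p22 - p12 * p21) * (A + p12 / p11 * B)) := by
  have hp0 : p11 ≠ 0 := hp.ne'
  have hD0 : p11 * p22 - p12 * p21 ≠ 0 := hD.ne'
  have key : (p11 * p22 - p12 * p21) / p11 * (B + p11 * p21 / (p11 * p22 - p12 * p21) * (A + p12 / p11 * B))
      = ((p11 * p22 - p12 * p21) * B + p11 * p21 * (A + p12 / p11 * B)) / p11 := by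
    field_simp
  rw [key, eq_div_iff hp0]
  field_simp
  ring

/-- **Rays TN ⟹ Hurwitz kernel TN.**  See the module docstring. -/
theorem hurwitz_tn_of_rays (X Y A B : ℕ → ℕ → ℝ) (p₁₁ p₁₂ p₂₁ p₂₂ : ℕ → ℝ)
    (h11 : ∀ n, 1 ≤ n → 0 < p₁₁ n) (h12 : ∀ n, 1 ≤ n → 0 ≤ p₁₂ n) (h21 : ∀ n, 1 ≤ n → 0 ≤ p₂₁ n)
    (hdet : ∀ n, 1 ≤ n → 0 < p₁₁ n * p₂₂ n - p₁₂ n * p₂₁ n)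
    (hY : ∀ n, 1 ≤ n → ∀ l, Y (n - 1) l = p₁₁ n * A n l + p₁₂ n * B n l)
    (hX : ∀ n, 1 ≤ n → ∀ l, X n l = p₂₁ n * A n l + p₂₂ n * B n l)
    (hG : ∀ (k : ℕ) (r c : Fin k → ℕ), StrictMono r → StrictMono c →
      0 ≤ (Matrix.of fun i j =>
        (if r i = 0 then X 0 (c j) else if r i % 2 = 1 then A ((r i + 1) / 2) (c j) else B (r i / 2) (c j))).det)
    {k : ℕ} (r c : Fin k → ℕ) (hr : StrictMono r) (hc : StrictMono c) :
    0 ≤ (Matrix.of fun i j => if r i % 2 = 0 then X (r i / 2) (c j) else Y (r i / 2) (c j)).det := by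
  -- the ray kernel and the two steps
  set G : ℕ → ℕ → ℝ := fun t l =>
    if t = 0 then X 0 l else if t % 2 = 1 then A ((t + 1) / 2) l else B (t / 2) l with hGdef
  set f : ℕ → ℝ := fun t => if t % 2 = 1 then p₁₂ ((t + 1) / 2) / p₁₁ ((t + 1) / 2) else 0 with hfdef
  set M1 : ℕ → ℕ → ℝ := fun t l => G t l + f t * G (t + 1) l with hM1def
  set e : ℕ → ℝ := fun t =>
    if t = 0 then 0 else if t % 2 = 0 then p₁₁ (t / 2) * p₂₁ (t / 2) / (p₁₁ (t / 2) * p₂₂ (t / 2) - p₁₂ (t / 2) * p₂₁ (t / 2))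
    else 0 with hedef
  set M2 : ℕ → ℕ → ℝ := fun t l => M1 t l + e t * M1 (t - 1) l with hM2def
  set d : ℕ → ℝ := fun t =>
    if t = 0 then 1 else if t % 2 = 1 then p₁₁ ((t + 1) / 2)
    else (p₁₁ (t / 2) * p₂₂ (t / 2) - p₁₂ (t / 2) * p₂₁ (t / 2)) / p₁₁ (t / 2) with hddef
  have hf : ∀ t, 0 ≤ f t := by
    intro t; simp only [hfdef]
    split_ifs with h
    · exact div_nonneg (h12 _ (by omega)) (h11 _ (by omega)).le
    · exact le_rfl
  have hf0 : f 0 = 0 := by simp [hfdef]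
  have he : ∀ t, 0 ≤ e t := by
    intro t; simp only [hedef]
    split_ifs with h0 h2
    · exact le_rfl
    · exact div_nonneg (mul_nonneg (h11 _ (by omega)).le (h21 _ (by omega))) (hdet _ (by omega)).le
    · exact le_rfl
  have he0 : e 0 = 0 := by simp [hedef]
  have hd : ∀ t, 0 ≤ d t := by
    intro t; simp only [hddef]
    split_ifs with h0 h1
    · exact zero_le_one
    · exact (h11 _ (by omega)).le
    · exact div_nonneg (hdet _ (by omega)).le (h11 _ (by omega)).le
  -- TN of M1 and M2
  have hM1 : ∀ (k : ℕ) (r c : Fin k → ℕ), StrictMono r → StrictMono c →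
      0 ≤ (Matrix.of fun i j => M1 (r i) (c j)).det := fun k r c hr hc =>
    DiffHurwitz.stepUp_tn G f hf hf0 hG r c hr hc
  have hM2 : ∀ (k : ℕ) (r c : Fin k → ℕ), StrictMono r → StrictMono c →
      0 ≤ (Matrix.of fun i j => M2 (r i) (c j)).det := fun k r c hr hc =>
    HurwitzPair.step_tn M1 e he he0 hM1 r c hr hc
  -- the Hurwitz kernel is the row scaling of M2 by d
  have hrow : ∀ t l, (if t % 2 = 0 then X (t / 2) l else Y (t / 2) l) = d t * M2 t l * 1 := by
    intro t l
    rw [mul_one]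
    rcases Nat.eq_zero_or_pos t with rfl | htpos
    · -- t = 0
      simp [hM2def, hM1def, hGdef, hddef, hedef, hfdef]
    rcases Nat.even_or_odd' t with ⟨n, rfl | rfl⟩
    · -- t = 2n, n ≥ 1 : X n = (det/p11) (B n + (p11 p21/det) · (Y(n-1))/p11 ... )
      have hn : 1 ≤ n := by omega
      have h1 : (2 * n) % 2 = 0 := by omega
      have h2 : (2 * n) / 2 = n := by omega
      have h3 : ¬ (2 * n) % 2 = 1 := by omega
      have h4 : (2 * n - 1) % 2 = 1 := by omega
      have h5 : (2 * n - 1 + 1) / 2 = n := by omega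
      have h6 : 2 * n ≠ 0 := by omega
      have h7 : 2 * n - 1 ≠ 0 := by omega
      have h8 : (2 * n - 1 + 1) = 2 * n := by omega
      rw [if_pos h1, h2]
      have h9 : ¬ (2 * n + 1 = 0) := by omega
      have hp := h11 n hn
      have hD := hdet n hn
      simp only [hM2def, hM1def, hGdef, hddef, hedef, hfdef]
      have h10 : (2 * n + 1) % 2 = 1 := by omega
      have h11' : (2 * n + 1 + 1) / 2 = n + 1 := by omega
      simp only [h1, h2, h4, h6, h7, h8, h9, h10, h11', if_true, if_false, zero_ne_one,
        zero_mul, add_zero, hX n hn l]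
      exact ray_identity (A n l) (B n l) (p₁₁ n) (p₁₂ n) (p₂₁ n) (p₂₂ n) hp hD
    · -- t = 2n+1 : Y n = p11 (n+1) · M1 (2n+1)
      have h1 : ¬ (2 * n + 1) % 2 = 0 := by omega
      have h2 : (2 * n + 1) / 2 = n := by omega
      have h3 : (2 * n + 1) % 2 = 1 := by omega
      have h5 : (2 * n + 1 + 1) / 2 = n + 1 := by omega
      have h6 : 2 * n + 1 ≠ 0 := by omega
      have h7 : ¬ (2 * n + 1 + 1) % 2 = 1 := by omega
      have h8 : (2 * n + 1 + 1) ≠ 0 := by omega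
      rw [if_neg h1, h2]
      have hp := h11 (n + 1) (by omega)
      have hYn := hY (n + 1) (by omega) l
      rw [Nat.add_sub_cancel] at hYn
      simp only [hM2def, hM1def, hGdef, hddef, hedef, hfdef]
      have h9 : 2 * n + 1 - 1 = 2 * n := by omega
      have h10 : ¬ (2 * n) % 2 = 1 := by omega
      have h12 : (2 * n) / 2 = n := by omega
      simp only [h2, h3, h5, h6, h7, h8, h9, h10, h12, if_true, if_false, one_ne_zero, zero_mul,
        add_zero, hYn]
      field_simp
  have heq : (Matrix.of fun i j => if r i % 2 = 0 then X (r i / 2) (c j) else Y (r i / 2) (c j)) =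
      Matrix.of fun i j => d (r i) * M2 (r i) (c j) * (fun _ : ℕ => (1 : ℝ)) (c j) := by
    ext i j; exact hrow (r i) (c j)
  rw [heq, TNKernel.det_kernel_scale M2 d (fun _ => (1 : ℝ)) r c]
  exact mul_nonneg (prod_nonneg fun i _ => hd _)
    (mul_nonneg (prod_nonneg fun j _ => zero_le_one) (hM2 k r c hr hc))

end ExtremeRay

end Summit.CriticalPhenomena.PercolationContinuityZ3.Theorems
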